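import Summits.CriticalPhenomena.PercolationContinuityZ3.Theorems.PercNearOneGluingNoHeavyLowerTailSahiCombMixCaterpillar

/-!
# The comb (tensor-Bernstein) hierarchy for Sahi's `E_k`, XLVII: GROWING an arbitrary hereditarily comb-positive family by OR/AND steps on fresh coordinates

Support file of the one-cut programme (crux `NoHeavyLowerTail`, stmt-CriticalPhenomena-4575; cell `prim-masterthm`, seat P3, gen 9;
`run/shared/lean/prim/prim-masterthm/prim-masterthm-p3/HIERARCHY.md` §17).  Sequel of `…SahiCombMixCaterpillar` (constant starts).  The induction behind
`combHereditary_caterpillar_four` needs nothing about the start except `CombHereditary`, monotonicity and that the steps read FRESH coordinates; this file records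
the general form and the bookkeeping it needs.
* **`CombHereditary.of_eq_biInter`** — `CombHereditary` passes to any family whose members are intersections of members (sub-families, duplicates, derived members
  `U_i ∩ U_j`, members `Ω`); `CombHereditary.update_empty` (a member `∅`); `CombHereditary.snoc_univ_three` (pad three events with `Ω`).
* `grow U L` — apply the step list `L` (`MixStep`: OR / AND a coordinate into selected members) to the start family `U`; `caterpillar c L = grow (constants) L`;
  `isUpperSet_grow`, `determinedBy_grow`, `secAt_grow_of_notMem`.
* **`combHereditary_grow_four`** — four increasing events determined by `S` with `CombHereditary U`, grown by any step list with pairwise distinct coordinates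
  outside `S`, stay `CombHereditary` (OR steps: comb H-MIX(4) `SahiCombMix.combHereditary_orCoord_four`; AND steps: `combHereditary_andCoord`);
  `combHereditary_grow_three`; law shadow `sahiE_grow_four_nonneg`.
* **`combHereditary_grow_four_of_cubic`** — THREE increasing events with comb-positive cubic row (any of the tree's comb `C_3` classes: core ≤ 3, `Z_3`-triples,
  OR-triples, all-but-two cylinders, junta intersections, …) plus a fourth member `Ω`, grown by OR/AND steps on fresh coordinates: the resulting quadruple is
  `CombHereditary`; in particular `E_4 ≥ 0` for it under every product measure.
HONEST FRAMING: Sahi's (M⁺-k) / `C_k` for general increasing events remain OPEN; this only closes the stated generated class. [this work]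
-/

noncomputable section

open scoped Classical

namespace Summit.CriticalPhenomena.PercolationContinuityZ3.Theorems

open Finset Function
open Literature.Combinatorics.Sahi2008
open Literature.Probability.Percolation (DeterminedBy determinedBy_iff determinedBy_univ)
open Literature.Probability.Percolation.DecisionTree (ind ind_of_mem ind_of_not_mem ind_nonneg)
open SahiComb
open SahiCombDisjunct (orCoord CombAllOrders)

variable {ι : Type} [Fintype ι]

namespace SahiCombHereditary

/-! ### Re-indexing: members that are intersections of members -/

omit [Fintype ι] in
/-- Rows of a family whose members are intersections of members of `U` are rows of `U`. [folklore] -/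
theorem biInter_biInter_eq {n n' : ℕ} (U : Fin n → Set (Set ι)) (T : Fin n' → Finset (Fin n)) (K : Finset (Fin n')) :
    (⋂ j ∈ K, ⋂ i ∈ T j, U i) = ⋂ i ∈ K.biUnion T, U i := by
  ext ω
  simp only [Set.mem_iInter, Finset.mem_biUnion]
  exact ⟨fun h i ⟨j, hj, hi⟩ => h j hj i hi, fun h j hj i hi => h i ⟨j, hj, hi⟩⟩

/-- **`CombHereditary` passes to any family of intersections of members** (sub-families, duplicated members, members `Ω` = empty intersections, derived
members `U_i ∩ U_j`, …). [this work] -/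
theorem CombHereditary.of_eq_biInter {n n' : ℕ} {U : Fin n → Set (Set ι)} (hU : CombHereditary U) (T : Fin n' → Finset (Fin n))
    {V : Fin n' → Set (Set ι)} (hV : ∀ j, V j = ⋂ i ∈ T j, U i) : CombHereditary V := by
  intro m K
  have e : (fun l => ind (⋂ j ∈ K l, V j)) = fun l => ind (⋂ i ∈ (K l).biUnion T, U i) := by
    funext l
    rw [← biInter_biInter_eq U T (K l)]
    congr 1
    exact Set.iInter_congr fun j => Set.iInter_congr fun _ => hV j
  rw [show (fun p => sahiE (bernoulliWeight p) m (fun l => ind (⋂ j ∈ K l, V j)))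
      = fun p => sahiE (bernoulliWeight p) m (fun l => ind (⋂ i ∈ (K l).biUnion T, U i)) from by rw [e]]
  exact hU m (fun l => (K l).biUnion T)

/-- A family with an EMPTY member: rows through that member vanish, the others are rows of the rest. [this work] -/
theorem CombHereditary.update_empty {n : ℕ} {U : Fin n → Set (Set ι)} (hU : CombHereditary U) (a : Fin n) :
    CombHereditary (update U a ∅) := by
  intro m K
  by_cases ha : ∃ l, a ∈ K l
  · obtain ⟨l, hl⟩ := ha
    have h0 : (⋂ i ∈ K l, update U a ∅ i) = ∅ :=
      Set.eq_empty_of_subset_empty fun ω hω => by simpa using Set.mem_iInter₂.1 hω a hl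
    refine (CombPos.zero _).congr fun p => ?_
    have e : (fun j => ind (⋂ i ∈ K j, update U a ∅ i)) = update (fun j => ind (⋂ i ∈ K j, update U a ∅ i)) l 0 := by
      funext j
      by_cases hj : j = l
      · subst hj
        rw [update_self, h0]
        funext ω; exact ind_of_not_mem (Set.notMem_empty ω)
      · rw [update_of_ne hj]
    rw [e, sahiE_update_zero]
  · have hK : ∀ l, (⋂ i ∈ K l, update U a ∅ i) = ⋂ i ∈ K l, U i := fun l =>
      Set.iInter_congr fun i => Set.iInter_congr fun hi => by
        have hia : i ≠ a := fun h => ha ⟨l, h ▸ hi⟩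
        rw [update_of_ne hia]
    refine (hU m K).congr fun p => ?_
    congr 1; funext l; rw [hK l]

/-- Padding THREE hereditarily comb-positive events with a fourth member `Ω`. [this work] -/
theorem CombHereditary.snoc_univ_three {U : Fin 3 → Set (Set ι)} (hU : CombHereditary U) :
    CombHereditary (![U 0, U 1, U 2, Set.univ] : Fin 4 → Set (Set ι)) := by
  refine hU.of_eq_biInter (![{0}, {1}, {2}, ∅] : Fin 4 → Finset (Fin 3)) fun j => ?_
  fin_cases j
  · show U 0 = ⋂ i ∈ ({0} : Finset (Fin 3)), U i; rw [Finset.set_biInter_singleton]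
  · show U 1 = ⋂ i ∈ ({1} : Finset (Fin 3)), U i; rw [Finset.set_biInter_singleton]
  · show U 2 = ⋂ i ∈ ({2} : Finset (Fin 3)), U i; rw [Finset.set_biInter_singleton]
  · show (Set.univ : Set (Set ι)) = ⋂ i ∈ (∅ : Finset (Fin 3)), U i; simp

/-! ### Growing a start family by steps on fresh coordinates -/

/-- Apply a step list (innermost = last element first) to a START family `U`. [this work] -/
def grow {n : ℕ} (U : Fin n → Set (Set ι)) : List (MixStep ι n) → Fin n → Set (Set ι)
  | [] => U
  | s :: L => mixStep (grow U L) s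

omit [Fintype ι] in
/-- The caterpillar families are the grown constant families. [this work] -/
theorem caterpillar_eq_grow {n : ℕ} (c : Fin n → Bool) :
    ∀ L : List (MixStep ι n), caterpillar c L = grow (fun j => bif c j then Set.univ else ∅) L
  | [] => rfl
  | s :: L => by
    show mixStep (caterpillar c L) s = mixStep (grow _ L) s
    rw [caterpillar_eq_grow c L]

omit [Fintype ι] in
/-- Grown members are increasing if the start is. [this work] -/
theorem isUpperSet_grow {n : ℕ} {U : Fin n → Set (Set ι)} (hU : ∀ j, IsUpperSet (U j)) :
    ∀ (L : List (MixStep ι n)) (j : Fin n), IsUpperSet (grow U L j)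
  | [], j => hU j
  | s :: L, j => by
    unfold grow mixStep
    cases s.op
    · exact isUpperSet_andCoord (isUpperSet_grow hU L) s.coord s.sel j
    · exact SahiCombDisjunct.isUpperSet_orCoord (isUpperSet_grow hU L) s.coord s.sel j

omit [Fintype ι] in
/-- Grown members are determined by the start's coordinates and the coordinates read. [this work] -/
theorem determinedBy_grow {n : ℕ} {U : Fin n → Set (Set ι)} {S : Set ι} (hU : ∀ j, DeterminedBy (U j) S) :
    ∀ (L : List (MixStep ι n)) (j : Fin n), DeterminedBy (grow U L j) (S ∪ stepCoords L)
  | [], j => (hU j).mono Set.subset_union_left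
  | ⟨op, e, G⟩ :: L, j => by
    have ih : DeterminedBy (grow U L j) (S ∪ stepCoords (⟨op, e, G⟩ :: L)) :=
      (determinedBy_grow hU L j).mono fun x hx => by
        simp only [stepCoords, List.map_cons, List.mem_cons, Set.mem_union, Set.mem_setOf_eq] at hx ⊢
        rcases hx with hx | hx
        · exact Or.inl hx
        · exact Or.inr (Or.inr hx)
    have hs : e ∈ S ∪ stepCoords (⟨op, e, G⟩ :: L) := by simp [stepCoords]
    have h := determinedBy_mix_coord ih hs op (G j)
    cases op <;> simpa [grow, mixStep, SahiCombDisjunct.orCoord, andCoord] using h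

omit [Fintype ι] in
/-- A grown family ignores every coordinate outside the start's coordinates and the coordinates read. [this work] -/
theorem secAt_grow_of_notMem {n : ℕ} {U : Fin n → Set (Set ι)} {S : Set ι} (hU : ∀ j, DeterminedBy (U j) S) (L : List (MixStep ι n))
    {e : ι} (heS : e ∉ S) (heL : e ∉ L.map MixStep.coord) (j : Fin n) (b : Bool) : secAt e b (grow U L j) = grow U L j :=
  SahiCombJunta.secAt_eq_self_of_determinedBy (determinedBy_grow hU L j) (by
    simp only [Set.mem_union, not_or]
    exact ⟨heS, heL⟩) b

/-- **GROWING FOUR HEREDITARILY COMB-POSITIVE EVENTS.**  Let `U_0,…,U_3` be increasing, determined by the coordinate set `S`, with `CombHereditary U`.  Every step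
list reading pairwise distinct coordinates OUTSIDE `S` grows `U` into a `CombHereditary` family (OR steps: comb H-MIX(4); AND steps: comb meet step). [this work] -/
theorem combHereditary_grow_four {U : Fin 4 → Set (Set ι)} (hUup : ∀ j, IsUpperSet (U j)) {S : Set ι} (hUS : ∀ j, DeterminedBy (U j) S)
    (hU : CombHereditary U) :
    ∀ (L : List (MixStep ι 4)), (L.map MixStep.coord).Nodup → (∀ s ∈ L, s.coord ∉ S) → CombHereditary (grow U L)
  | [], _, _ => hU
  | s :: L, hL, hS => by
    rw [List.map_cons, List.nodup_cons] at hL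
    have ih := combHereditary_grow_four hUup hUS hU L hL.2 fun t ht => hS t (List.mem_cons_of_mem s ht)
    have hup := isUpperSet_grow hUup L
    have hig := secAt_grow_of_notMem hUS L (hS s List.mem_cons_self) hL.1
    show CombHereditary (mixStep (grow U L) s)
    unfold mixStep
    cases s.op
    · exact combHereditary_andCoord _ s.coord s.sel hig ih
    · exact SahiCombMix.combHereditary_orCoord_four _ s.coord s.sel hup hig ih

/-- The same for THREE members. [this work] -/
theorem combHereditary_grow_three {U : Fin 3 → Set (Set ι)} (hUup : ∀ j, IsUpperSet (U j)) {S : Set ι} (hUS : ∀ j, DeterminedBy (U j) S)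
    (hU : CombHereditary U) :
    ∀ (L : List (MixStep ι 3)), (L.map MixStep.coord).Nodup → (∀ s ∈ L, s.coord ∉ S) → CombHereditary (grow U L)
  | [], _, _ => hU
  | s :: L, hL, hS => by
    rw [List.map_cons, List.nodup_cons] at hL
    have ih := combHereditary_grow_three hUup hUS hU L hL.2 fun t ht => hS t (List.mem_cons_of_mem s ht)
    have hup := isUpperSet_grow hUup L
    have hig := secAt_grow_of_notMem hUS L (hS s List.mem_cons_self) hL.1
    show CombHereditary (mixStep (grow U L) s)
    unfold mixStep
    cases s.op
    · exact combHereditary_andCoord _ s.coord s.sel hig ih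
    · exact combHereditaryMixture_three _ s.coord s.sel hup hig ih

/-- **From a positive cubic row to a grown quadruple.**  Three increasing events determined by `S` whose single cubic row `E_3(μ_p; U_0,U_1,U_2)` is comb-positive
(any of the tree's comb `C_3` classes), a fourth member `Ω`, and any OR/AND step list on fresh coordinates: the grown quadruple is `CombHereditary` — every row of
its ∩-closed family, in particular `E_4` of the four grown events, has nonnegative tensor-Bernstein coefficients. [this work] -/
theorem combHereditary_grow_four_of_cubic (U : Fin 3 → Set (Set ι)) (hUup : ∀ j, IsUpperSet (U j)) {S : Set ι} (hUS : ∀ j, DeterminedBy (U j) S)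
    (h3 : CombPos (fun _ : ι => 3) (fun p => sahiE (bernoulliWeight p) 3 (fun j => ind (U j))))
    (L : List (MixStep ι 4)) (hL : (L.map MixStep.coord).Nodup) (hS : ∀ s ∈ L, s.coord ∉ S) :
    CombHereditary (grow (![U 0, U 1, U 2, Set.univ] : Fin 4 → Set (Set ι)) L) := by
  refine combHereditary_grow_four (fun j => ?_) (S := S) (fun j => ?_) (combHereditary_three_of_cubic U hUup h3).snoc_univ_three L hL hS
  · fin_cases j
    · exact hUup 0
    · exact hUup 1
    · exact hUup 2
    · exact isUpperSet_univ
  · fin_cases j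
    · exact hUS 0
    · exact hUS 1
    · exact hUS 2
    · exact determinedBy_univ _

/-- Law-level shadow of `combHereditary_grow_four`: all rows nonnegative under every product measure. [this work] -/
theorem sahiE_grow_four_nonneg {U : Fin 4 → Set (Set ι)} (hUup : ∀ j, IsUpperSet (U j)) {S : Set ι} (hUS : ∀ j, DeterminedBy (U j) S)
    (hU : CombHereditary U) (L : List (MixStep ι 4)) (hL : (L.map MixStep.coord).Nodup) (hS : ∀ s ∈ L, s.coord ∉ S)
    (p : ι → unitInterval) (m : ℕ) (K : Fin m → Finset (Fin 4)) :
    0 ≤ sahiE (bernoulliWeight p) m (fun j => ind (⋂ i ∈ K j, grow U L i)) :=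
  ((combHereditary_grow_four hUup hUS hU L hL hS).hereditaryAllOrders p) m K

end SahiCombHereditary

end Summit.CriticalPhenomena.PercolationContinuityZ3.Theorems

end
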